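import Summits.NavierStokesRegularity.FluidComputer.ForcedContinuationHolds
import Summits.NavierStokesRegularity.FluidComputer.PalasekTowerHeredityWitnessUnconditional
import Literature.Analysis.FluidPDE.ClassicalSupStabilityBootstrap
import Literature.Analysis.FluidPDE.ForcedOseenPointwiseEnergyBound
import Literature.Analysis.FluidPDE.TaoForcedEnergyBoundDischarge
import Literature.Analysis.FluidPDE.NSEnstrophyPersistenceForced
import Literature.Analysis.FluidPDE.NSTaoClassOfSobolevDatum
import Literature.Analysis.FluidPDE.NSLerayStrongLocalExistence

/-!
# THE PERTURBED RUN, I: tools — coherent families of classical solutions on initial slabs, and forced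
# runs from a Schwartz datum next to a bounded free run (bound, uniqueness, local existence)

Cell `ns-blowup`, seat `ns-blowup-ecbridge-3` (g6; D-0074 GROUP C «BRIDGE SUPPORT», lineage
`host_preparation`; bears_on LADDER-NS N1, route `PalasekTowerBreakdown`, crux `EpisodeBase` = item
stmt-NavierStokesRegularity-19179, line `slot` v5, stub `stub_explicit_slice_run : ExplicitSliceRun`).
LABEL: E–C typing + kernel analysis (theorems only; no definition, no named fact, no `sorry`).
WHAT THIS IS NOT: not Navier–Stokes evidence — bookkeeping for GIVEN classical solutions of the forced
system on a FIXED slab next to a GIVEN free run; no stage, host, episode or blow-up is constructed or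
asserted. Companion (part II): `PalasekTowerPerturbedRun.lean` (the existence theorem).

* §1 `normalise_pressure`, `congr_pressure'`, `pressure_sub_apply_zero_eq_of_eqOn_Icc` (the velocity
  determines the normalised pressure up to the INITIAL time — one-sided time derivatives within two
  initial slabs agree), `isClassicalNSSolutionOn_Ico_of_forall_Icc` (classical on every closed initial
  sub-slab ⇒ classical on the half-open slab).
* §2 next to an unforced bounded classical run `(u, p)` on `[0, T]` (`‖u‖ ≤ M`, Schwartz datum) and
  under a Clay-class force `f` with `‖f(t)‖₂ ≤ G₂` small in the sense of `ClassicalSupStabilityBootstrap`: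
  `forcedRun_near` (every classical finite-energy forced run from `u 0` on `[0, s] ⊆ [0, T]` is within
  `1/2` of `u`, quantitatively, and bounded by `M + 1/2` — Tao class
  `IsClassicalNSSolutionOn.hasBoundedSobolevNormsOn_of_clayForce`, re-gauging to the Leray-projected
  force `IsClassicalNSSolutionOn.to_clayProjForce`, `norm_le_of_bootstrap`), `forcedRun_unique`
  (`velocity_eq_of_bounded_classical`, W14-free), `exists_local_forcedRun`
  (`tao2011_smooth_local_existence_forced_holds`).

References: T. Tao, Anal. PDE 6 (2013), Thm. 5.4, Lemma 8.1, Cor. 11.1 [cite: Tao2011, Thm. 5.4 (ii)+(iv)];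
P. G. Lemarié-Rieusset (2016), Thm. 11.2 (11.11) [cite: LemarieRieusset2016, Thm. 11.2 (11.11)];
J. Leray, Acta Math. 63 (1934) §19 [cite: Leray1934, §19 (3.4)–(3.8)]; S. Palasek, arXiv:2605.13827 §4
[cite: Palasek2026ElementaryModel, §4].
-/

noncomputable section

namespace Summit.NavierStokesRegularity.FluidComputer.PalasekTowerClayBridge.PerturbedRun

open Set MeasureTheory Filter Topology Function Real
open scoped ENNReal NNReal ContDiff
open Literature.Analysis.FluidPDE

/-! ## §1 Small tools on classical solutions -/

section Tools

variable {ν : ℝ} {f u : ℝ → EuclideanSpace ℝ (Fin 3) → EuclideanSpace ℝ (Fin 3)}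
  {p : ℝ → EuclideanSpace ℝ (Fin 3) → ℝ}

/-- Normalising the pressure at the spatial origin keeps a classical solution classical (the
gradient ignores the subtracted function of time). [folklore] -/
theorem normalise_pressure {S : Set ℝ} (h : IsClassicalNSSolutionOn S ν f u p) :
    IsClassicalNSSolutionOn S ν f u (fun t x => p t x - p t 0) where
  smooth_velocity := h.smooth_velocity
  smooth_pressure := h.smooth_pressure.sub_apply_zero
  momentum t ht x := by
    rw [gradient_sub_const]
    exact h.momentum t ht x
  divFree := h.divFree

/-- Changing the pressure to one that agrees on the time set keeps a classical solution classical.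
[folklore] -/
theorem congr_pressure' {S : Set ℝ} {q : ℝ → EuclideanSpace ℝ (Fin 3) → ℝ}
    (h : IsClassicalNSSolutionOn S ν f u p) (hqp : ∀ t ∈ S, q t = p t) :
    IsClassicalNSSolutionOn S ν f u q where
  smooth_velocity := h.smooth_velocity
  smooth_pressure := h.smooth_pressure.congr fun z hz => by
    change q z.1 z.2 = p z.1 z.2
    rw [hqp z.1 (mem_prod.1 hz).1]
  momentum t ht x := by
    rw [hqp t ht]
    exact h.momentum t ht x
  divFree := h.divFree

/-- Two initial slabs `[0, s₁]`, `[0, s₂]` coincide near every `t < min s₁ s₂`. [folklore] -/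
theorem Icc_eventuallyEq_Icc {s₁ s₂ t : ℝ} (ht₁ : t < s₁) (ht₂ : t < s₂) :
    (Icc (0 : ℝ) s₁ : Set ℝ) =ᶠ[𝓝 t] (Icc (0 : ℝ) s₂ : Set ℝ) := by
  have hmem : Iio (min s₁ s₂) ∈ 𝓝 t := Iio_mem_nhds (lt_min ht₁ ht₂)
  filter_upwards [hmem] with τ hτ
  have h1 : τ < s₁ := lt_of_lt_of_le hτ (min_le_left _ _)
  have h2 : τ < s₂ := lt_of_lt_of_le hτ (min_le_right _ _)
  simp only [eq_iff_iff]
  exact ⟨fun h => ⟨h.1, h2.le⟩, fun h => ⟨h.1, h1.le⟩⟩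

/-- An initial closed slab and an initial half-open slab coincide near every `t` below both right
ends. [folklore] -/
theorem Icc_eventuallyEq_Ico {s₁ s₂ t : ℝ} (ht₁ : t < s₁) (ht₂ : t < s₂) :
    (Icc (0 : ℝ) s₁ : Set ℝ) =ᶠ[𝓝 t] (Ico (0 : ℝ) s₂ : Set ℝ) := by
  have hmem : Iio (min s₁ s₂) ∈ 𝓝 t := Iio_mem_nhds (lt_min ht₁ ht₂)
  filter_upwards [hmem] with τ hτ
  have h1 : τ < s₁ := lt_of_lt_of_le hτ (min_le_left _ _)
  have h2 : τ < s₂ := lt_of_lt_of_le hτ (min_le_right _ _)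
  simp only [eq_iff_iff]
  exact ⟨fun h => ⟨h.1, h2⟩, fun h => ⟨h.1, h1.le⟩⟩

/-- **The velocity determines the normalised pressure, up to the initial time.** Two classical
solutions (same `ν`, same force) on `[0, s₁]` and `[0, s₂]` whose velocities agree on `[0, m]`,
`0 < m ≤ min s₁ s₂`, have the same normalised pressure at every `t ∈ [0, m)` (including `t = 0`, where
the one-sided time derivatives within the two slabs agree). [folklore] -/
theorem pressure_sub_apply_zero_eq_of_eqOn_Icc {s₁ s₂ m : ℝ}
    {u₁ u₂ : ℝ → EuclideanSpace ℝ (Fin 3) → EuclideanSpace ℝ (Fin 3)}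
    {p₁ p₂ : ℝ → EuclideanSpace ℝ (Fin 3) → ℝ}
    (h₁ : IsClassicalNSSolutionOn (Icc 0 s₁) ν f u₁ p₁) (h₂ : IsClassicalNSSolutionOn (Icc 0 s₂) ν f u₂ p₂)
    (hm₁ : m ≤ s₁) (hm₂ : m ≤ s₂) (heq : ∀ τ ∈ Icc 0 m, u₁ τ = u₂ τ) {t : ℝ} (ht : t ∈ Ico 0 m)
    (x : EuclideanSpace ℝ (Fin 3)) : p₁ t x - p₁ t 0 = p₂ t x - p₂ t 0 := by
  have ht₁ : t ∈ Icc 0 s₁ := ⟨ht.1, ht.2.le.trans hm₁⟩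
  have ht₂ : t ∈ Icc 0 s₂ := ⟨ht.1, ht.2.le.trans hm₂⟩
  have hts₁ : t < s₁ := lt_of_lt_of_le ht.2 hm₁
  have hts₂ : t < s₂ := lt_of_lt_of_le ht.2 hm₂
  -- the pressure gradients agree at time `t`
  have hgrad : ∀ y, gradient (p₁ t) y = gradient (p₂ t) y := by
    intro y
    have hd : timeDerivWithin (Icc 0 s₁) u₁ t y = timeDerivWithin (Icc 0 s₂) u₂ t y := by
      simp only [timeDerivWithin_apply]
      rw [derivWithin_congr_set (Icc_eventuallyEq_Icc hts₁ hts₂)]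
      refine Filter.EventuallyEq.derivWithin_eq ?_ (by rw [heq t ⟨ht.1, ht.2.le⟩])
      have hmem : Iio m ∈ 𝓝[Icc 0 s₂] t := mem_nhdsWithin_of_mem_nhds (Iio_mem_nhds ht.2)
      filter_upwards [hmem, self_mem_nhdsWithin] with τ hτ hτ'
      rw [heq τ ⟨hτ'.1, le_of_lt hτ⟩]
    have heqt : u₁ t = u₂ t := heq t ⟨ht.1, ht.2.le⟩
    have hmo₁ := h₁.momentum t ht₁ y
    have hmo₂ := h₂.momentum t ht₂ y
    rw [hd, heqt] at hmo₁
    have h12 := hmo₁.symm.trans hmo₂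
    simpa using h12
  -- hence the pressures differ by a constant in `x`
  have hd₁ : Differentiable ℝ (p₁ t) := (h₁.contDiff_pressure ht₁).differentiable (by simp)
  have hd₂ : Differentiable ℝ (p₂ t) := (h₂.contDiff_pressure ht₂).differentiable (by simp)
  have hdiff : Differentiable ℝ (fun y => p₁ t y - p₂ t y) := hd₁.sub hd₂
  have hzero : ∀ y, fderiv ℝ (fun y => p₁ t y - p₂ t y) y = 0 := by
    intro y
    rw [fderiv_fun_sub (hd₁ y) (hd₂ y)]
    have hg := hgrad y
    unfold gradient at hg
    rw [(InnerProductSpace.toDual ℝ (EuclideanSpace ℝ (Fin 3))).symm.injective hg, sub_self]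
  have hc := is_const_of_fderiv_eq_zero hdiff hzero x 0
  linarith

/-- **A classical solution on every closed initial sub-slab is a classical solution on the half-open
slab** (smoothness is local; the one-sided time derivatives within `[0, τ₁]` and `[0, τ)` agree at
`t < τ₁`). [folklore] -/
theorem isClassicalNSSolutionOn_Ico_of_forall_Icc {τ : ℝ} (hτ : 0 < τ)
    (h : ∀ τ₁ ∈ Ioo 0 τ, IsClassicalNSSolutionOn (Icc 0 τ₁) ν f u p) :
    IsClassicalNSSolutionOn (Ico 0 τ) ν f u p := by
  -- for `t ∈ [0, τ)` a closed sub-slab reaching past `t`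
  have hmid : ∀ t ∈ Ico 0 τ, (t + τ) / 2 ∈ Ioo 0 τ ∧ t < (t + τ) / 2 := fun t ht =>
    ⟨⟨by linarith [ht.1], by linarith [ht.2]⟩, by linarith [ht.2]⟩
  have hsmooth : ∀ {F : Type} [NormedAddCommGroup F] [NormedSpace ℝ F]
      (w : ℝ → EuclideanSpace ℝ (Fin 3) → F),
      (∀ τ₁ ∈ Ioo 0 τ, IsSmoothSpaceTimeOn (Icc 0 τ₁) w) → IsSmoothSpaceTimeOn (Ico 0 τ) w := by
    intro F _ _ w hw
    refine contDiffOn_of_locally_contDiffOn fun z hz => ?_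
    obtain ⟨ht, -⟩ := mem_prod.1 hz
    obtain ⟨hτ₁, htτ₁⟩ := hmid z.1 ht
    refine ⟨Iio ((z.1 + τ) / 2) ×ˢ univ, isOpen_Iio.prod isOpen_univ, mk_mem_prod htτ₁ (mem_univ _), ?_⟩
    refine ContDiffOn.mono (hw _ hτ₁) ?_
    rintro q ⟨⟨hq1, -⟩, hq2, -⟩
    exact mk_mem_prod ⟨hq1.1, le_of_lt hq2⟩ (mem_univ _)
  refine ⟨hsmooth u fun τ₁ hτ₁ => (h τ₁ hτ₁).smooth_velocity,
    hsmooth p fun τ₁ hτ₁ => (h τ₁ hτ₁).smooth_pressure, fun t ht x => ?_, fun t ht => ?_⟩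
  · obtain ⟨hτ₁, htτ₁⟩ := hmid t ht
    have hm := (h _ hτ₁).momentum t ⟨ht.1, htτ₁.le⟩ x
    have hd : timeDerivWithin (Ico 0 τ) u t x = timeDerivWithin (Icc 0 ((t + τ) / 2)) u t x := by
      simp only [timeDerivWithin_apply]
      rw [derivWithin_congr_set (Icc_eventuallyEq_Ico htτ₁ ht.2)]
    rw [hd]
    exact hm
  · obtain ⟨hτ₁, htτ₁⟩ := hmid t ht
    exact (h _ hτ₁).divFree t ⟨ht.1, htτ₁.le⟩

end Tools

/-! ## §2 Forced runs from a Schwartz datum next to a bounded free run -/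

section Runs

variable {ν T M G₂r : ℝ} {f u : ℝ → EuclideanSpace ℝ (Fin 3) → EuclideanSpace ℝ (Fin 3)}
  {p : ℝ → EuclideanSpace ℝ (Fin 3) → ℝ}

/-- The energy of a field is the `L²` norm of its `0`-th derivative. [folklore] -/
private theorem lintegral_enorm_sq_eq_iteratedFDeriv_zero'
    (v : EuclideanSpace ℝ (Fin 3) → EuclideanSpace ℝ (Fin 3)) :
    ∫⁻ x, ‖v x‖ₑ ^ 2 = ∫⁻ x, ‖iteratedFDeriv ℝ 0 v x‖ₑ ^ 2 :=
  lintegral_congr fun x => by rw [← ofReal_norm, ← ofReal_norm, norm_iteratedFDeriv_zero]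

/-- **Every forced run from the datum of the free run stays within `1/2` of it** (and is bounded by
`M + 1/2`). Let `(u, p)` be an unforced classical run on `[0, T] × ℝ³` (`ν > 0`) with finite energy,
`‖u‖ ≤ M` (`M > 0`) and Schwartz datum, `f` a Clay-class force with `‖f(t)‖₂ ≤ G₂` on `[0, T]` and
`2 (0 + 4 ν^{-3/4} T^{1/4} G₂) exp (36 C₀² (M+(M+1))² T / ν) ≤ 1/2`. Then every classical finite-energy
solution `(u', p')` of the system forced by `f` on `[0, s]`, `0 < s ≤ T`, with `u' 0 = u 0` satisfies
`‖u'(t,x) − u(t,x)‖ ≤ 2 (0 + 4 ν^{-3/4} s^{1/4} G₂) exp (36 C₀² (M+(M+1))² t / ν) ≤ 1/2` and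
`‖u'(t,x)‖ ≤ M + 1/2` for `t ∈ [0, s]`. The a-priori bound on `u'` needed by the stability estimate is
supplied by Tao's class (the run is bounded by SOME constant) and the bootstrap
`norm_le_of_bootstrap`, after re-gauging `f` to its Leray projection.
[cite: Tao2011, Thm. 5.4 (ii)+(iv)] [cite: Leray1934, §19 (3.4)–(3.8)] -/
theorem forcedRun_near (hν : 0 < ν) (hT : 0 < T)
    (hs : IsSmoothOnHalfSpace f) (hd : HasRapidSpaceTimeDecay f)
    (hu : IsClassicalNSSolutionOn (Icc 0 T) ν 0 u p)
    (hE : ∃ C : ℝ≥0∞, C < ⊤ ∧ ∀ t ∈ Icc 0 T, ∫⁻ x, ‖u t x‖ₑ ^ 2 ≤ C)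
    (hM : 0 < M) (hbd : ∀ t ∈ Icc 0 T, ∀ x, ‖u t x‖ ≤ M) (h0 : HasRapidSpatialDecay (u 0))
    (hG₂r : 0 ≤ G₂r) (hfL2 : ∀ t ∈ Icc 0 T, eLpNorm (f t) 2 volume ≤ ENNReal.ofReal G₂r)
    (hΦ : 2 * (0 + 4 * ν ^ (-(3 / 4 : ℝ)) * T ^ (1 / 4 : ℝ) * G₂r) *
      Real.exp (36 * oseenSliceConst (EuclideanSpace ℝ (Fin 3)) ^ 2 * (M + (M + 1)) ^ 2 / ν * T) ≤
        1 / 2)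
    {s : ℝ} (hs0 : 0 < s) (hsT : s ≤ T)
    {u' : ℝ → EuclideanSpace ℝ (Fin 3) → EuclideanSpace ℝ (Fin 3)} {p' : ℝ → EuclideanSpace ℝ (Fin 3) → ℝ}
    (hcl' : IsClassicalNSSolutionOn (Icc 0 s) ν f u' p') (hu'0 : u' 0 = u 0)
    (hE' : ∃ C : ℝ≥0∞, C < ⊤ ∧ ∀ t ∈ Icc 0 s, ∫⁻ x, ‖u' t x‖ₑ ^ 2 ≤ C) :
    ∀ t ∈ Icc 0 s, ∀ x, ‖u' t x - u t x‖ ≤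
        2 * (0 + 4 * ν ^ (-(3 / 4 : ℝ)) * s ^ (1 / 4 : ℝ) * G₂r) *
          Real.exp (36 * oseenSliceConst (EuclideanSpace ℝ (Fin 3)) ^ 2 * (M + (M + 1)) ^ 2 / ν * t) ∧
      ‖u' t x - u t x‖ ≤ 1 / 2 ∧ ‖u' t x‖ ≤ M + 1 / 2 := by
  set lam : ℝ := 36 * oseenSliceConst (EuclideanSpace ℝ (Fin 3)) ^ 2 * (M + (M + 1)) ^ 2 / ν
    with hlam_def
  have hlam0 : 0 ≤ lam := by positivity
  have hsub : Icc 0 s ⊆ Icc 0 T := Icc_subset_Icc le_rfl hsT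
  have hfs : IsSmoothSpaceTimeOn (Icc 0 s) f := hs.isSmoothSpaceTimeOn_Icc s
  have hfd : HasUniformRapidDecayOn (Icc 0 s) f := hd.hasUniformRapidDecayOn_Icc hs hs0
  -- the smallness at `s ≤ T`
  have hΦs : 2 * (0 + 4 * ν ^ (-(3 / 4 : ℝ)) * s ^ (1 / 4 : ℝ) * G₂r) * Real.exp (lam * s) ≤ 1 / 2 := by
    have h1 : s ^ (1 / 4 : ℝ) ≤ T ^ (1 / 4 : ℝ) := Real.rpow_le_rpow hs0.le hsT (by norm_num)
    have h2 : Real.exp (lam * s) ≤ Real.exp (lam * T) := Real.exp_le_exp.2 (by nlinarith)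
    calc 2 * (0 + 4 * ν ^ (-(3 / 4 : ℝ)) * s ^ (1 / 4 : ℝ) * G₂r) * Real.exp (lam * s)
        ≤ 2 * (0 + 4 * ν ^ (-(3 / 4 : ℝ)) * T ^ (1 / 4 : ℝ) * G₂r) * Real.exp (lam * T) := by
          gcongr
      _ ≤ 1 / 2 := by rw [hlam_def]; exact hΦ
  -- the free run on `[0, s]`
  have hus : IsClassicalNSSolutionOn (Icc 0 s) ν 0 u p := hu.mono hsub (uniqueDiffOn_Icc hs0)
  have hEs : ∃ C : ℝ≥0∞, C < ⊤ ∧ ∀ t ∈ Icc 0 s, ∫⁻ x, ‖u t x‖ₑ ^ 2 ≤ C := by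
    obtain ⟨C, hC, hb⟩ := hE; exact ⟨C, hC, fun t ht => hb t (hsub ht)⟩
  -- the forced run is Tao-class, hence bounded by some `B`
  have hE'nn : ∃ C : ℝ≥0, ∀ t ∈ Icc 0 s, ∫⁻ x, ‖u' t x‖ₑ ^ 2 ≤ C := by
    obtain ⟨C, hC, hb⟩ := hE'
    exact ⟨C.toNNReal, fun t ht => (hb t ht).trans (ENNReal.coe_toNNReal hC.ne).ge⟩
  have h0' : HasRapidSpatialDecay (u' 0) := by rw [hu'0]; exact h0
  have hTao := hcl'.hasBoundedSobolevNormsOn_of_clayForce hν hs0 hE'nn h0' hs hd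
  obtain ⟨B, -, hB⟩ := HasBoundedSobolevNormsOn.exists_forall_norm_iteratedFDeriv_le hTao
    (fun t ht => hcl'.contDiff_velocity ht) 0
  have hbd' : ∀ t ∈ Icc 0 s, ∀ y, ‖u' t y‖ ≤ B := fun t ht y => by
    simpa using hB t ht y
  -- re-gauge the force to its Leray projection
  have hclP := hcl'.to_clayProjForce hs0 hfs hfd
  obtain ⟨G, -, hG⟩ := exists_norm_clayProjForce_le hs0 hfs hfd
  have hgPc := continuous_uncurry_clayProjForce hs0 hfs hfd
  have hgPdiv : ∀ τ ∈ Icc 0 s, IsWeaklyDivFree (clayProjForce hs0 hfs hfd τ) := fun τ _ =>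
    isWeaklyDivFree_clayProjForce hs0 hfs hfd τ
  have hgPL2 : ∀ τ ∈ Icc 0 s, eLpNorm (clayProjForce hs0 hfs hfd τ) 2 volume ≤ ENNReal.ofReal G₂r := by
    intro τ hτ
    refine (eLpNorm_two_clayProjForce_le hs0 hfs hfd τ).trans ?_
    rw [FourierNS.clamp_of_mem hτ]
    exact hfL2 τ (hsub hτ)
  have hD : ∀ y, ‖u' 0 y - u 0 y‖ ≤ 0 := fun y => by rw [hu'0, sub_self, norm_zero]
  rw [hlam_def] at hΦs
  intro t ht x
  have h1 := sup_stability_forced_free_bootstrap hν hs0 hus hclP hgPc (fun τ _ y => hG τ y) hgPdiv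
    hG₂r hgPL2 hEs hE' hM (fun t ht => hbd t (hsub ht)) hbd' hD hΦs t ht x
  have h2 := norm_le_of_bootstrap hν hs0 hus hclP hgPc (fun τ _ y => hG τ y) hgPdiv hG₂r hgPL2 hEs
    hE' hM (fun t ht => hbd t (hsub ht)) hbd' hD hΦs t ht x
  exact ⟨h1, h2.1, h2.2⟩

/-- **Forced runs from the datum of the free run are unique on their common slab** (W14-free: the
shorter run is bounded by `M + 1/2`, `forcedRun_near`; `velocity_eq_of_bounded_classical`).
[cite: Tao2011, Thm. 5.4 (ii)+(iv)] -/
theorem forcedRun_unique (hν : 0 < ν) (hT : 0 < T)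
    (hs : IsSmoothOnHalfSpace f) (hd : HasRapidSpaceTimeDecay f)
    (hu : IsClassicalNSSolutionOn (Icc 0 T) ν 0 u p)
    (hE : ∃ C : ℝ≥0∞, C < ⊤ ∧ ∀ t ∈ Icc 0 T, ∫⁻ x, ‖u t x‖ₑ ^ 2 ≤ C)
    (hM : 0 < M) (hbd : ∀ t ∈ Icc 0 T, ∀ x, ‖u t x‖ ≤ M) (h0 : HasRapidSpatialDecay (u 0))
    (hG₂r : 0 ≤ G₂r) (hfL2 : ∀ t ∈ Icc 0 T, eLpNorm (f t) 2 volume ≤ ENNReal.ofReal G₂r)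
    (hΦ : 2 * (0 + 4 * ν ^ (-(3 / 4 : ℝ)) * T ^ (1 / 4 : ℝ) * G₂r) *
      Real.exp (36 * oseenSliceConst (EuclideanSpace ℝ (Fin 3)) ^ 2 * (M + (M + 1)) ^ 2 / ν * T) ≤
        1 / 2)
    {s s' : ℝ} (hs0 : 0 < s) (hss' : s ≤ s') (hs'T : s' ≤ T)
    {u₁ u₂ : ℝ → EuclideanSpace ℝ (Fin 3) → EuclideanSpace ℝ (Fin 3)}
    {p₁ p₂ : ℝ → EuclideanSpace ℝ (Fin 3) → ℝ}
    (h₁ : IsClassicalNSSolutionOn (Icc 0 s) ν f u₁ p₁) (h₁0 : u₁ 0 = u 0)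
    (hE₁ : ∃ C : ℝ≥0∞, C < ⊤ ∧ ∀ t ∈ Icc 0 s, ∫⁻ x, ‖u₁ t x‖ₑ ^ 2 ≤ C)
    (h₂ : IsClassicalNSSolutionOn (Icc 0 s') ν f u₂ p₂) (h₂0 : u₂ 0 = u 0)
    (hE₂ : ∃ C : ℝ≥0∞, C < ⊤ ∧ ∀ t ∈ Icc 0 s', ∫⁻ x, ‖u₂ t x‖ₑ ^ 2 ≤ C) :
    ∀ t ∈ Icc 0 s, u₂ t = u₁ t := by
  have hsub : Icc 0 s ⊆ Icc 0 s' := Icc_subset_Icc le_rfl hss'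
  have h₂' : IsClassicalNSSolutionOn (Icc 0 s) ν f u₂ p₂ := h₂.mono hsub (uniqueDiffOn_Icc hs0)
  have hE₂' : ∃ C : ℝ≥0∞, C < ⊤ ∧ ∀ t ∈ Icc 0 s, ∫⁻ x, ‖u₂ t x‖ₑ ^ 2 ≤ C := by
    obtain ⟨C, hC, hb⟩ := hE₂; exact ⟨C, hC, fun t ht => hb t (hsub ht)⟩
  have hB₁ : ∀ t ∈ Icc 0 s, ∀ x, ‖u₁ t x‖ ≤ M + 1 / 2 := fun t ht x =>
    (forcedRun_near hν hT hs hd hu hE hM hbd h0 hG₂r hfL2 hΦ hs0 (hss'.trans hs'T) h₁ h₁0 hE₁ t ht x).2.2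
  exact velocity_eq_of_bounded_classical hν hs0 hs hd h₁ hE₁ hB₁ h₂' hE₂' (h₂0.trans h₁0.symm)

/-- **A local classical run of the forced system from a Schwartz datum** (Tao's forced local theory,
lifespan from the `H¹` sizes of the datum and of the Clay force). [cite: Tao2011, Thm. 5.4 (ii)+(iv)] -/
theorem exists_local_forcedRun (hν : 0 < ν) (hT : 0 < T)
    (hs : IsSmoothOnHalfSpace f) (hd : HasRapidSpaceTimeDecay f)
    {a : EuclideanSpace ℝ (Fin 3) → EuclideanSpace ℝ (Fin 3)} (ha_smooth : ContDiff ℝ ∞ a)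
    (ha_div : VectorCalculus.IsDivFree a) (ha0 : HasRapidSpatialDecay a) :
    ∃ s₁ : ℝ, 0 < s₁ ∧ s₁ ≤ T ∧
      ∃ (u' : ℝ → EuclideanSpace ℝ (Fin 3) → EuclideanSpace ℝ (Fin 3))
        (p' : ℝ → EuclideanSpace ℝ (Fin 3) → ℝ),
        IsClassicalNSSolutionOn (Icc 0 s₁) ν f u' p' ∧ u' 0 = a ∧
        (∃ C : ℝ≥0∞, C < ⊤ ∧ ∀ t ∈ Icc 0 s₁, ∫⁻ x, ‖u' t x‖ₑ ^ 2 ≤ C) := by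
  obtain ⟨c, hc, hloc⟩ := tao2011_smooth_local_existence_forced_holds
  obtain ⟨Cf₀, Cf₁, Bf, hBf0, -, -, hBf⟩ := ForcedContinuation.exists_force_slice_bounds hs hd
  have ha_Hinf : ∀ m : ℕ, ∫⁻ x, ‖iteratedFDeriv ℝ m a x‖ₑ ^ 2 < ⊤ := fun m =>
    ha0.lintegral_enorm_iteratedFDeriv_sq_lt_top m
  -- the `H¹` size of the datum
  set K₀ : ℝ≥0∞ := (∫⁻ x, ‖a x‖ₑ ^ 2) +
    ∫⁻ x, ENNReal.ofReal (frobeniusNormSq (fderiv ℝ a x)) with hK₀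
  have hK₀t : K₀ < ⊤ := by
    refine ENNReal.add_lt_top.2 ⟨?_, ?_⟩
    · rw [lintegral_enorm_sq_eq_iteratedFDeriv_zero']; exact ha_Hinf 0
    · exact (lintegral_frobeniusNormSq_le_three_mul_iteratedFDeriv_one a).trans_lt
        (ENNReal.mul_lt_top (by simp) (ha_Hinf 1))
  set A : ℝ := Real.sqrt K₀.toReal with hA
  have hA0 : 0 ≤ A := Real.sqrt_nonneg _
  have hA2 : ENNReal.ofReal (A ^ 2) = K₀ := by
    rw [hA, Real.sq_sqrt ENNReal.toReal_nonneg, ENNReal.ofReal_toReal hK₀t.ne]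
  -- the lifespan
  set s₁ : ℝ := min T (min 1 (c * ν ^ 3 / (A + Bf + 1) ^ 4)) with hs₁
  have hs₁T : s₁ ≤ T := min_le_left _ _
  have hs₁1 : s₁ ≤ 1 := (min_le_right _ _).trans (min_le_left _ _)
  have hs₁c : s₁ ≤ c * ν ^ 3 / (A + Bf + 1) ^ 4 := (min_le_right _ _).trans (min_le_right _ _)
  have hs₁pos : 0 < s₁ := lt_min hT (lt_min one_pos (by positivity))
  have hsmall : (A + Bf * s₁) ^ 4 * s₁ ≤ c * ν ^ 3 := by
    have h1 : A + Bf * s₁ ≤ A + Bf + 1 := by nlinarith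
    have h2 : 0 ≤ A + Bf * s₁ := by positivity
    calc (A + Bf * s₁) ^ 4 * s₁ ≤ (A + Bf + 1) ^ 4 * s₁ :=
          mul_le_mul_of_nonneg_right (pow_le_pow_left₀ h2 h1 4) hs₁pos.le
      _ ≤ (A + Bf + 1) ^ 4 * (c * ν ^ 3 / (A + Bf + 1) ^ 4) :=
          mul_le_mul_of_nonneg_left hs₁c (by positivity)
      _ = c * ν ^ 3 := by field_simp
  have hdat : (∫⁻ x, ‖a x‖ₑ ^ 2) +
      (∫⁻ x, ENNReal.ofReal (frobeniusNormSq (fderiv ℝ a x))) ≤ ENNReal.ofReal (A ^ 2) := by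
    rw [hA2]
  have hfB : ∀ t ∈ Icc 0 s₁, (∫⁻ x, ‖f t x‖ₑ ^ 2) +
      (∫⁻ x, ENNReal.ofReal (frobeniusNormSq (fderiv ℝ (f t) x))) ≤ ENNReal.ofReal (Bf ^ 2) :=
    fun t ht => hBf t ht.1
  obtain ⟨w, q, hw, hw0, hwS, -, -, -⟩ := hloc hν hs₁pos ha_smooth ha_div ha_Hinf
    (hs.isSmoothSpaceTimeOn_Icc s₁) (hd.hasUniformRapidDecayOn_Icc hs hs₁pos) hA0 hBf0 hdat hfB hsmall
  refine ⟨s₁, hs₁pos, hs₁T, w, q, hw, hw0, ?_⟩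
  obtain ⟨C, hC⟩ := hwS 0
  exact ⟨C, ENNReal.coe_lt_top, fun t ht => by
    rw [lintegral_enorm_sq_eq_iteratedFDeriv_zero']; exact hC t ht⟩

end Runs

end Summit.NavierStokesRegularity.FluidComputer.PalasekTowerClayBridge.PerturbedRun

end
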